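import Mathlib.GroupTheory.Perm.Fin
import Mathlib.GroupTheory.Subgroup.Centralizer
import Mathlib.GroupTheory.OrderOfElement
import Mathlib.Tactic.IntervalCases
import Literature.IUT.HodgeTheaters.ConjugacyIndeterminacies
import HarnessLib

/-!
# A witness for [IUTchI] Remark 4.5.1 (i): "`(H, J)` and `(H, J^g)` need not be isomorphic" — abc-iut cell, layer L5

Mochizuki, *Inter-universal Teichmüller theory I*, §4, Remark 4.5.1 (i) p. 109: "the subgroups `J`, `J^g` of `H` are
not necessarily conjugate in `H`; indeed, the abstract pairs … `(H, J)` and `(H, J^g)` need not be isomorphic [i.e., it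
is not even necessarily the case that there exists an automorphism of `H` that maps `J` onto `J^g`]". The named
statement `Rmk451.PairsNeedNotBeIso` (`ConjugacyIndeterminacies.lean`) is DISCHARGED here by the witness
`G = 𝔖₄`, `p = (0 2)(1 3)`, `H = C_G(p) ≅ D₈`, `J = ⟨p⟩ = Z(H)`, `g = (1 2)`, `J^g = ⟨(0 1)(2 3)⟩ ⊆ H`: `J` is central,
hence normal, in `H`, while `J^g` is not normalised by the `4`-cycle `c = (0 1 2 3) ∈ H`; normality being preserved
by automorphisms of `H`, no automorphism carries `J` onto `J^g`. [claim: Mochizuki2012, status: disputed]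
-/

namespace Literature.IUT.HodgeTheaters

namespace Rmk451

open Equiv

/-- `p = (0 2)(1 3) ∈ 𝔖₄`. [claim: Mochizuki2012, status: disputed] -/
def wP : Perm (Fin 4) := swap 0 2 * swap 1 3

/-- `p' = (0 1)(2 3) ∈ 𝔖₄`. [claim: Mochizuki2012, status: disputed] -/
def wP' : Perm (Fin 4) := swap 0 1 * swap 2 3

/-- `g = (1 2) ∈ 𝔖₄`, conjugating `p` to `p'`. [claim: Mochizuki2012, status: disputed] -/
def wG : Perm (Fin 4) := swap 1 2

/-- `c = (0 1 2 3) ∈ 𝔖₄`, a `4`-cycle commuting with `p` but not normalising `⟨p'⟩`. [claim: Mochizuki2012, status: disputed] -/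
def wC : Perm (Fin 4) := swap 0 1 * swap 1 2 * swap 2 3

/-- The finite computations behind the witness. [claim: Mochizuki2012, status: disputed] -/
theorem witness_computations :
    wG * wP * wG⁻¹ = wP' ∧ wP * wP' = wP' * wP ∧ wP * wC = wC * wP ∧ wP' * wP' = 1 ∧ wP' ≠ 1 ∧
      wC * wP' * wC⁻¹ ≠ 1 ∧ wC * wP' * wC⁻¹ ≠ wP' := by
  unfold wG wP wP' wC
  decide

/-- `⟨p'⟩ = {1, p'}`. [claim: Mochizuki2012, status: disputed] -/
theorem mem_zpowers_wP'_iff (y : Perm (Fin 4)) : y ∈ Subgroup.zpowers wP' ↔ y = 1 ∨ y = wP' := by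
  obtain ⟨-, -, -, h4, h5, -, -⟩ := witness_computations
  have ho : orderOf wP' = 2 := orderOf_eq_prime (by rw [pow_two, h4]) h5
  rw [mem_zpowers_iff_mem_range_orderOf, ho]
  simp only [Finset.mem_image, Finset.mem_range]
  constructor
  · rintro ⟨k, hk, rfl⟩
    interval_cases k
    · left; rw [pow_zero]
    · right; rw [pow_one]
  · rintro (rfl | rfl)
    · exact ⟨0, by omega, by rw [pow_zero]⟩
    · exact ⟨1, by omega, by rw [pow_one]⟩

/-- **Remark 4.5.1 (i) holds**: the pairs `(H, J)`, `(H, J^g)` need not be isomorphic (witness in `𝔖₄`).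
[claim: Mochizuki2012, status: disputed] -/
theorem pairsNeedNotBeIso_holds : PairsNeedNotBeIso := by
  obtain ⟨h1, h2, h3, h4, h5, h6, h7⟩ := witness_computations
  refine ⟨Perm (Fin 4), inferInstance, Subgroup.centralizer {wP}, Subgroup.zpowers wP, wG, ?_, ?_, ?_⟩
  · rw [Subgroup.zpowers_le, Subgroup.mem_centralizer_iff]
    intro h hh
    rw [Set.mem_singleton_iff] at hh
    rw [hh]
  · rw [conjSubgroup, MonoidHom.map_zpowers, Subgroup.zpowers_le, Subgroup.mem_centralizer_iff]
    intro h hh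
    rw [Set.mem_singleton_iff] at hh
    subst hh
    change wP * (wG * wP * wG⁻¹) = wG * wP * wG⁻¹ * wP
    rw [h1, h2]
  · rintro ⟨σ, hσ⟩
    -- `J = ⟨p⟩` is central, hence normal, in `H = C(p)`
    have hN : ((Subgroup.zpowers wP).subgroupOf (Subgroup.centralizer {wP})).Normal := by
      refine ⟨fun n hn h => ?_⟩
      rw [Subgroup.mem_subgroupOf] at hn ⊢
      obtain ⟨k, hk⟩ := Subgroup.mem_zpowers_iff.1 hn
      have hc : Commute wP (h : Perm (Fin 4)) := Subgroup.mem_centralizer_iff.1 h.2 wP rfl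
      have hck : Commute (wP ^ k) (h : Perm (Fin 4)) := hc.zpow_left k
      rw [Subgroup.coe_mul, Subgroup.coe_mul, Subgroup.coe_inv, ← hk, ← hck.eq, mul_inv_cancel_right]
      exact ⟨k, rfl⟩
    -- transport normality along `σ` to `J^g ∩ H`
    have hN' := hN.map σ.toMonoidHom σ.surjective
    rw [hσ] at hN'
    -- the `4`-cycle `c ∈ H` fails to normalise `⟨p'⟩`
    have hcH : wC ∈ Subgroup.centralizer ({wP} : Set (Perm (Fin 4))) := by
      rw [Subgroup.mem_centralizer_iff]; intro h hh; rw [Set.mem_singleton_iff] at hh; subst hh; exact h3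
    have hp'H : wP' ∈ Subgroup.centralizer ({wP} : Set (Perm (Fin 4))) := by
      rw [Subgroup.mem_centralizer_iff]; intro h hh; rw [Set.mem_singleton_iff] at hh; subst hh; exact h2
    have hp'J : (⟨wP', hp'H⟩ : Subgroup.centralizer ({wP} : Set (Perm (Fin 4)))) ∈
        (conjSubgroup (Subgroup.zpowers wP) wG).subgroupOf (Subgroup.centralizer {wP}) := by
      rw [Subgroup.mem_subgroupOf, conjSubgroup, MonoidHom.map_zpowers]
      change wP' ∈ Subgroup.zpowers (wG * wP * wG⁻¹)
      rw [h1]; exact Subgroup.mem_zpowers _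
    have hconj := hN'.conj_mem _ hp'J ⟨wC, hcH⟩
    rw [Subgroup.mem_subgroupOf, conjSubgroup, MonoidHom.map_zpowers] at hconj
    change wC * wP' * wC⁻¹ ∈ Subgroup.zpowers (wG * wP * wG⁻¹) at hconj
    rw [h1, mem_zpowers_wP'_iff] at hconj
    rcases hconj with h | h
    · exact h6 h
    · exact h7 h

end Rmk451

end Literature.IUT.HodgeTheaters
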